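import Summits.Langlands.Langlands.Theorems.SqrtFiveQuarticCoversCertS3H12Y2Lift

/-!
# Route `Langlands/SqrtFiveQuarticCovers`, certificate `CertS3H12` (sheet 4.7): KERNEL LIFT TESTS,
# part B — the exceptional classes 8, 9, 10 of `Y₂ = X(s3,ns⁺5)` over totally real quartic fields

Cell `pub/lg-quartmod` (F-L1), engine seat eng-4 g4 (item S3H12-Y2CENSUS).  Continuation of
`Theorems/SqrtFiveQuarticCoversCertS3H12Y2Lift.lean` (generic lemmas `exists_kPair_eq_of_finrank_four`,
`liftTest_core`, `conic_conj`, the `ℚ(r)` non-square tests, and the four classes over fields that are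
not totally real); the remaining classes are in part A.  For each class `i` of this file — a
quadratic-point class of the `(t, n, ṽ)`-model of `Y₂ = X(s3,ns⁺5)` over `k = ℚ(r)`, `r² = 5`, whose
field `K_i = k(√Δ_i)` IS totally real — we prove the LIFT TEST: if `t ∈ K` satisfies the class
equation `t² + P_i(r)·t + C_i(r) = 0` in a quartic number field `K ∋ r`, then the `H12`-conic
`(5 ± 2r)·w² = 8t² − 12t + 7` has NO solution `w ∈ K`; i.e. no point of `X = X(s3,H12)` with
coordinates in `K` lies over this class.  Pattern (see the main file's docstring): `s := 2t + P_i`,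
`s² = Δ_i ∉ ℚ(r)²`, `K = ℚ(r) ⊕ ℚ(r)s`, `w = x + ys`, split along `{1, s}`, `z = (5+2r)(x² − Δy²) ∈ ℚ(r)`
with `z² = N_i := Q₀² − Δ·Q₁²`, and `N_i` is not a square in `ℚ(r)` (class 9: `N = 49`, then
`(5+2r)x² ∈ {9, 2}` is impossible instead).  Constants: eng-4 g4 `evidence/e8y2/y2census_classes.json`
(pure-python exact arithmetic), cross-checked against eng-5 `exceptional11-j317331.json`; every
identity is re-verified here by `linear_combination`, every non-square by `norm_num` on integers.

HONEST STATUS: support lemmas only (explicit algebra; no hypothesis beyond the class equation, no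
definition, no named fact); they close nothing on the ledger by themselves; the completeness of the
eleven-class list stays NAMED (`hY2`, sibling census file); «a certified finite datum is not a
modularity statement»; nothing here proves modularity of any elliptic curve.
References: cell files E8-POINTS.md (eng-4), R5-E8-Y2FORM-6F.md (eng-5); [Zywina2015] §1.2–1.3.
-/

noncomputable section

set_option linter.dupNamespace false -- project-wide option; `Summit.Langlands.Langlands` is the mandated namespace

open scoped IntermediateField
open NumberField Polynomial

namespace Summit.Langlands.Langlands.Theorems.SqrtFiveQuarticCovers

/-- **Class 8** (K disc 5^2 5441, sig (4,0)): `t² + P·t + C = 0`, `P = (13/14 + (-17/14)*r)`, `C = (23/14 + (-9/14)*r)`;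
`s := 2t + P`, `s² = Δ = (163/98 + (31/98)*r)` (totally positive; not a square in `ℚ(r)`);
`8t² − 12t + 7 = Q₀ + Q₁s`, `Q₀ = (1586/49 + (-547/49)*r)`, `Q₁ = (-68/7 + (34/7)*r)`, and
`N = Q₀² − Δ·Q₁² = (71875/49 + (-4430/7)*r)` is not a square in `ℚ(r)` — so the conic
`(5 ± 2r)·w² = 8t² − 12t + 7` has no solution `w` in a quartic `K ∋ r, t` (lift test, `liftTest_core`).
(eng-4 g4 `y2census_classes.json` class 8; eng-5 `exceptional11-j317331.json`; `B ∉ K²` = eng-4 E8-POINTS /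
eng-5 j316521 / ref-1 liftchk.) [folklore] -/
theorem y2class08_no_lift {K : Type} [Field K] [NumberField K] (hd : Module.finrank ℚ K = 4)
    {r t : K} (hr : r ^ 2 = 5) (ht : t ^ 2 + (((13/14 : ℚ) : K) + ((-17/14 : ℚ) : K) * r) * t + (((23/14 : ℚ) : K) + ((-9/14 : ℚ) : K) * r) = 0) (w : K) :
    (5 + 2 * r) * w ^ 2 ≠ 8 * t ^ 2 - 12 * t + 7 ∧ (5 - 2 * r) * w ^ 2 ≠ 8 * t ^ 2 - 12 * t + 7 := by
  have hr_mem : r ∈ ℚ⟮r⟯ := IntermediateField.mem_adjoin_simple_self ℚ r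
  have ht' := ht
  push_cast at ht'
  have hs : (2 * t + ((13/14 : K) + (-17/14 : K) * r)) ^ 2 = ((163/98 : K) + (31/98 : K) * r) := by
    linear_combination 4 * ht' + (289/196 : K) * hr
  have hΔ : ((163/98 : K) + (31/98 : K) * r) ∈ ℚ⟮r⟯ := by
    exact (add_mem (div_mem (ofNat_mem _ 163) (ofNat_mem _ 98)) (mul_mem (div_mem (ofNat_mem _ 31) (ofNat_mem _ 98)) hr_mem))
  have hsk : (2 * t + ((13/14 : K) + (-17/14 : K) * r)) ∉ ℚ⟮r⟯ := by
    intro hmem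
    obtain ⟨e, f, hef⟩ := exists_rat_add_rat_mul_of_mem_adjoin hr hmem
    have key : ((e : K) + (f : K) * r) ^ 2 = ((163/98 : ℚ) : K) + ((31/98 : ℚ) : K) * r := by
      rw [← hef, hs]; push_cast; ring
    have hNS : ¬ IsSquare ((163/98 : ℚ) ^ 2 - 5 * (31/98 : ℚ) ^ 2) := by
      intro hsq
      have h3 := isSquare_mul_sq_of_isSquare hsq (49 : ℚ)
      norm_num at h3
    exact not_sq_eq_of_not_isSquare_norm hr hNS e f key
  have aux : ∀ w : K, (5 + 2 * r) * w ^ 2 ≠ 8 * t ^ 2 - 12 * t + 7 := by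
    intro w hw
    obtain ⟨x, hx, y, hy, hxy⟩ := exists_kPair_eq_of_finrank_four hd hr hsk w
    have hQ₀ : ((1586/49 : K) + (-547/49 : K) * r) ∈ ℚ⟮r⟯ := by
      exact (add_mem (div_mem (ofNat_mem _ 1586) (ofNat_mem _ 49)) (mul_mem (div_mem (neg_mem (ofNat_mem _ 547)) (ofNat_mem _ 49)) hr_mem))
    have hQ₁ : ((-68/7 : K) + (34/7 : K) * r) ∈ ℚ⟮r⟯ := by
      exact (add_mem (div_mem (neg_mem (ofNat_mem _ 68)) (ofNat_mem _ 7)) (mul_mem (div_mem (ofNat_mem _ 34) (ofNat_mem _ 7)) hr_mem))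
    have h' : (5 + 2 * r) * (x + y * (2 * t + ((13/14 : K) + (-17/14 : K) * r))) ^ 2 = ((1586/49 : K) + (-547/49 : K) * r) + ((-68/7 : K) + (34/7 : K) * r) * (2 * t + ((13/14 : K) + (-17/14 : K) * r)) := by
      rw [← hxy]
      linear_combination hw + 2 * hs + (289/98 : K) * hr
    obtain ⟨-, -, e3, hz⟩ := liftTest_core hs hsk hΔ hx hy hQ₀ hQ₁ h'
    obtain ⟨e, f, hef⟩ := exists_rat_add_rat_mul_of_mem_adjoin hr hz
    have hN : ((e : K) + (f : K) * r) ^ 2 = ((71875/49 : ℚ) : K) + ((-4430/7 : ℚ) : K) * r := by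
      rw [← hef, e3]; push_cast; linear_combination ((276667/2401 : K) + (-17918/2401 : K) * r) * hr
    have hNS : ¬ IsSquare ((71875/49 : ℚ) ^ 2 - 5 * (-4430/7 : ℚ) ^ 2) := by
      intro hsq
      have h3 := isSquare_mul_sq_of_isSquare hsq (49 : ℚ)
      norm_num at h3
    exact not_sq_eq_of_not_isSquare_norm hr hNS e f hN
  exact ⟨aux w, fun h => aux _ (conic_conj hr h)⟩

/-- **Class 9** (CM, `D = −32`, `j ∈ ℚ(√2)`; `K = ℚ(√2, √5)`, disc `2⁶5²`, totally real):
`t² − 1/2 = 0`, `s := 2t`, `s² = Δ = 2` (not a square in `ℚ(r)`); `8t² − 12t + 7 = 11 − 6s`,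
`N = 11² − 2·6² = 49 = 7²` IS a square, so the norm test is silent; but `z = (5+2r)(x² − 2y²) = ±7`
together with `(5+2r)(x² + 2y²) = 11` forces `(5+2r)·x² ∈ {9, 2}`, i.e. `x² ∈ {9 − (18/5)r,
2 − (4/5)r}` with `x ∈ ℚ(r)` — norms `81/5`, `4/5`, not rational squares.  Hence the conic
`(5 ± 2r)·w² = 8t² − 12t + 7` has no solution `w ∈ K`.  (eng-4 g4 `y2census_classes.json` class 9;
E8-POINTS row `S = 2G, λ = −1`; eng-5 class `(2G, 1) [D = −32]`.) [folklore] -/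
theorem y2class09_no_lift {K : Type} [Field K] [NumberField K] (hd : Module.finrank ℚ K = 4)
    {r t : K} (hr : r ^ 2 = 5) (ht : t ^ 2 + ((-1/2 : ℚ) : K) = 0) (w : K) :
    (5 + 2 * r) * w ^ 2 ≠ 8 * t ^ 2 - 12 * t + 7 ∧ (5 - 2 * r) * w ^ 2 ≠ 8 * t ^ 2 - 12 * t + 7 := by
  have ht' := ht
  push_cast at ht'
  have hs : (2 * t) ^ 2 = (2 : K) := by
    linear_combination 4 * ht'
  have hΔ : (2 : K) ∈ ℚ⟮r⟯ := by
    exact ofNat_mem _ 2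
  have hsk : (2 * t) ∉ ℚ⟮r⟯ := by
    intro hmem
    obtain ⟨e, f, hef⟩ := exists_rat_add_rat_mul_of_mem_adjoin hr hmem
    have key : ((e : K) + (f : K) * r) ^ 2 = ((2 : ℚ) : K) := by
      rw [← hef, hs]; push_cast; ring
    have h1 : ¬ IsSquare (2 : ℚ) := by norm_num
    have h5 : ¬ IsSquare (5 * (2 : ℚ)) := by norm_num
    exact not_sq_eq_ratCast hr h1 h5 e f key
  have aux : ∀ w : K, (5 + 2 * r) * w ^ 2 ≠ 8 * t ^ 2 - 12 * t + 7 := by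
    intro w hw
    obtain ⟨x, hx, y, hy, hxy⟩ := exists_kPair_eq_of_finrank_four hd hr hsk w
    have hQ₀ : (11 : K) ∈ ℚ⟮r⟯ := by
      exact ofNat_mem _ 11
    have hQ₁ : (-6 : K) ∈ ℚ⟮r⟯ := by
      exact neg_mem (ofNat_mem _ 6)
    have h' : (5 + 2 * r) * (x + y * (2 * t)) ^ 2 = (11 : K) + (-6 : K) * (2 * t) := by
      rw [← hxy]
      linear_combination hw + 2 * hs
    obtain ⟨e1, -, e3, hz⟩ := liftTest_core hs hsk hΔ hx hy hQ₀ hQ₁ h'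
    obtain ⟨e, f, hef⟩ := exists_rat_add_rat_mul_of_mem_adjoin hr hz
    have hN : ((e : K) + (f : K) * r) ^ 2 = ((49 : ℚ) : K) + ((0 : ℚ) : K) * r := by
      rw [← hef, e3]; push_cast; ring
    obtain ⟨h1, h2, -⟩ := isSquare_norm_of_sq_eq hr hN
    rcases mul_eq_zero.mp (show e * f = 0 by linarith) with he | hf
    · -- `e = 0`: `5f² = 49`, i.e. `(5f)² = 245` — not a rational square
      subst he
      have h245 : IsSquare (245 : ℚ) := ⟨5 * f, by linear_combination (-5 : ℚ) * h1⟩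
      norm_num at h245
    · -- `f = 0`: `e = ±7`, and `2(5+2r)x² = 11 + e`
      subst hf
      have he : e = 7 ∨ e = -7 := by
        have h49 : (e - 7) * (e + 7) = 0 := by linear_combination h1
        rcases mul_eq_zero.mp h49 with h | h
        · left; linarith
        · right; linarith
      obtain ⟨a, b, hab⟩ := exists_rat_add_rat_mul_of_mem_adjoin hr hx
      have hz' : (5 + 2 * r) * (x ^ 2 - 2 * y ^ 2) = (e : K) := by
        rw [hef]; push_cast; ring
      have hx2 : 2 * ((5 + 2 * r) * x ^ 2) = 11 + (e : K) := by
        linear_combination e1 + hz'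
      rcases he with rfl | rfl
      · -- `(5+2r)x² = 9`, `x² = 9 − (18/5)r`, norm `81/5`
        have key : ((a : K) + (b : K) * r) ^ 2 = ((9 : ℚ) : K) + ((-18/5 : ℚ) : K) * r := by
          rw [← hab]
          push_cast at hx2 ⊢
          linear_combination ((5 - 2 * r) / 10) * hx2 + (4 * x ^ 2 / 5) * hr
        have hNS : ¬ IsSquare ((9 : ℚ) ^ 2 - 5 * (-18/5 : ℚ) ^ 2) := by
          intro hsq
          have h3 := isSquare_mul_sq_of_isSquare hsq (5 : ℚ)
          norm_num at h3
        exact not_sq_eq_of_not_isSquare_norm hr hNS a b key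
      · -- `(5+2r)x² = 2`, `x² = 2 − (4/5)r`, norm `4/5`
        have key : ((a : K) + (b : K) * r) ^ 2 = ((2 : ℚ) : K) + ((-4/5 : ℚ) : K) * r := by
          rw [← hab]
          push_cast at hx2 ⊢
          linear_combination ((5 - 2 * r) / 10) * hx2 + (4 * x ^ 2 / 5) * hr
        have hNS : ¬ IsSquare ((2 : ℚ) ^ 2 - 5 * (-4/5 : ℚ) ^ 2) := by
          intro hsq
          have h3 := isSquare_mul_sq_of_isSquare hsq (5 : ℚ)
          norm_num at h3
        exact not_sq_eq_of_not_isSquare_norm hr hNS a b key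
  exact ⟨aux w, fun h => aux _ (conic_conj hr h)⟩

/-- **Class 10** (K disc 5^2 11 59, sig (4,0)): `t² + P·t + C = 0`, `P = (101/76 + (-31/76)*r)`, `C = (-13/8 + (1/8)*r)`;
`s := 2t + P`, `s² = Δ = (26275/2888 + (-4575/2888)*r)` (totally positive; not a square in `ℚ(r)`);
`8t² − 12t + 7 = Q₀ + Q₁s`, `Q₀ = (13850/361 + (-2810/361)*r)`, `Q₁ = (-215/19 + (31/19)*r)`, and
`N = Q₀² − Δ·Q₁² = (70875/361 + (-13500/361)*r)` is not a square in `ℚ(r)` — so the conic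
`(5 ± 2r)·w² = 8t² − 12t + 7` has no solution `w` in a quartic `K ∋ r, t` (lift test, `liftTest_core`).
(eng-4 g4 `y2census_classes.json` class 10; eng-5 `exceptional11-j317331.json`; `B ∉ K²` = eng-4 E8-POINTS /
eng-5 j316521 / ref-1 liftchk.) [folklore] -/
theorem y2class10_no_lift {K : Type} [Field K] [NumberField K] (hd : Module.finrank ℚ K = 4)
    {r t : K} (hr : r ^ 2 = 5) (ht : t ^ 2 + (((101/76 : ℚ) : K) + ((-31/76 : ℚ) : K) * r) * t + (((-13/8 : ℚ) : K) + ((1/8 : ℚ) : K) * r) = 0) (w : K) :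
    (5 + 2 * r) * w ^ 2 ≠ 8 * t ^ 2 - 12 * t + 7 ∧ (5 - 2 * r) * w ^ 2 ≠ 8 * t ^ 2 - 12 * t + 7 := by
  have hr_mem : r ∈ ℚ⟮r⟯ := IntermediateField.mem_adjoin_simple_self ℚ r
  have ht' := ht
  push_cast at ht'
  have hs : (2 * t + ((101/76 : K) + (-31/76 : K) * r)) ^ 2 = ((26275/2888 : K) + (-4575/2888 : K) * r) := by
    linear_combination 4 * ht' + (961/5776 : K) * hr
  have hΔ : ((26275/2888 : K) + (-4575/2888 : K) * r) ∈ ℚ⟮r⟯ := by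
    exact (add_mem (div_mem (ofNat_mem _ 26275) (ofNat_mem _ 2888)) (mul_mem (div_mem (neg_mem (ofNat_mem _ 4575)) (ofNat_mem _ 2888)) hr_mem))
  have hsk : (2 * t + ((101/76 : K) + (-31/76 : K) * r)) ∉ ℚ⟮r⟯ := by
    intro hmem
    obtain ⟨e, f, hef⟩ := exists_rat_add_rat_mul_of_mem_adjoin hr hmem
    have key : ((e : K) + (f : K) * r) ^ 2 = ((26275/2888 : ℚ) : K) + ((-4575/2888 : ℚ) : K) * r := by
      rw [← hef, hs]; push_cast; ring
    have hNS : ¬ IsSquare ((26275/2888 : ℚ) ^ 2 - 5 * (-4575/2888 : ℚ) ^ 2) := by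
      intro hsq
      have h3 := isSquare_mul_sq_of_isSquare hsq (76 : ℚ)
      norm_num at h3
    exact not_sq_eq_of_not_isSquare_norm hr hNS e f key
  have aux : ∀ w : K, (5 + 2 * r) * w ^ 2 ≠ 8 * t ^ 2 - 12 * t + 7 := by
    intro w hw
    obtain ⟨x, hx, y, hy, hxy⟩ := exists_kPair_eq_of_finrank_four hd hr hsk w
    have hQ₀ : ((13850/361 : K) + (-2810/361 : K) * r) ∈ ℚ⟮r⟯ := by
      exact (add_mem (div_mem (ofNat_mem _ 13850) (ofNat_mem _ 361)) (mul_mem (div_mem (neg_mem (ofNat_mem _ 2810)) (ofNat_mem _ 361)) hr_mem))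
    have hQ₁ : ((-215/19 : K) + (31/19 : K) * r) ∈ ℚ⟮r⟯ := by
      exact (add_mem (div_mem (neg_mem (ofNat_mem _ 215)) (ofNat_mem _ 19)) (mul_mem (div_mem (ofNat_mem _ 31) (ofNat_mem _ 19)) hr_mem))
    have h' : (5 + 2 * r) * (x + y * (2 * t + ((101/76 : K) + (-31/76 : K) * r))) ^ 2 = ((13850/361 : K) + (-2810/361 : K) * r) + ((-215/19 : K) + (31/19 : K) * r) * (2 * t + ((101/76 : K) + (-31/76 : K) * r)) := by
      rw [← hxy]
      linear_combination hw + 2 * hs + (961/2888 : K) * hr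
    obtain ⟨-, -, e3, hz⟩ := liftTest_core hs hsk hΔ hx hy hQ₀ hQ₁ h'
    obtain ⟨e, f, hef⟩ := exists_rat_add_rat_mul_of_mem_adjoin hr hz
    have hN : ((e : K) + (f : K) * r) ^ 2 = ((70875/361 : ℚ) : K) + ((-13500/361 : ℚ) : K) * r := by
      rw [← hef, e3]; push_cast; linear_combination ((-23066225/1042568 : K) + (4396575/1042568 : K) * r) * hr
    have hm : (3375/19 : ℚ) ^ 2 = (70875/361 : ℚ) ^ 2 - 5 * (-13500/361 : ℚ) ^ 2 := by norm_num
    have hp : ¬ IsSquare (((70875/361 : ℚ) + 3375/19) / 2) := by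
      intro hsq
      have h3 := isSquare_mul_sq_of_isSquare hsq (19 : ℚ)
      norm_num at h3
    have hn : ¬ IsSquare (((70875/361 : ℚ) - 3375/19) / 2) := by
      intro hsq
      have h3 := isSquare_mul_sq_of_isSquare hsq (19 : ℚ)
      norm_num at h3
    exact not_sq_eq_of_not_isSquare_halves hr (3375/19 : ℚ) hm hp hn e f hN
  exact ⟨aux w, fun h => aux _ (conic_conj hr h)⟩

end Summit.Langlands.Langlands.Theorems.SqrtFiveQuarticCovers

end
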